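import Literature.Analysis.FunctionSpaces.BVLevelSets
import Literature.Analysis.FunctionSpaces.BVComposition
import HarnessLib

/-!
# Almost every level set is finite — local version along a compact set of parameters

Topic `Literature/Analysis/FunctionSpaces`.  Combination of `BVLevelSets.lean` (a.e. level set of
a continuous BV function on `[a, b]` is finite) and `BVComposition.lean` (locally Lipschitz ∘
continuous BV path is BV): **if `γ` is a continuous path of bounded variation on `[a, b]`, `F` is
Lipschitz near every point of an open set `O`, and `T ⊆ [a, b]` is a compact set of parameters
with `γ(T) ⊆ O`, then for almost every `s` the set `{t ∈ T | F (γ t) = s}` is finite**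
(`ae_finite_levelSet_inter_of_isCompact`).  The point is that `F ∘ γ` need not make sense (or be
of bounded variation) on all of `[a, b]`: `T` is covered by finitely many closed intervals on
which `γ` stays in `O` (`exists_finset_Icc_cover`).  This is the form used for general position
in Schramm–Smirnov's Theorem 1.7 (`F` = a level function of the inverse conformal chart of a
quad, defined and locally Lipschitz only inside the quad).

## References

* H. Federer, *Geometric Measure Theory* (1969), 2.10.25. [Federer1969]
* O. Schramm, S. Smirnov, Ann. Probab. 39 (2011), §2. [SchrammSmirnov2011]
-/

noncomputable section

open Set Metric MeasureTheory Filter Topology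
open scoped NNReal

namespace Literature.Analysis.FunctionSpaces

/-- **Finite cover of a compact set of reals by closed intervals inside an open set.**  If
`T ⊆ U` with `T` compact and `U` open in `ℝ`, there are finitely many closed intervals
`[cᵢ - rᵢ, cᵢ + rᵢ] ⊆ U` (`rᵢ > 0`) covering `T`. [folklore] -/
theorem exists_finset_Icc_cover {T U : Set ℝ} (hT : IsCompact T) (hU : IsOpen U) (hTU : T ⊆ U) :
    ∃ P : Finset (ℝ × ℝ), (∀ p ∈ P, 0 < p.2 ∧ Icc (p.1 - p.2) (p.1 + p.2) ⊆ U) ∧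
      T ⊆ ⋃ p ∈ P, Icc (p.1 - p.2) (p.1 + p.2) := by
  classical
  have hnhd : ∀ t ∈ T, ∃ r > 0, Icc (t - 2 * r) (t + 2 * r) ⊆ U := fun t ht => by
    obtain ⟨ε, hε, hball⟩ := Metric.isOpen_iff.1 hU t (hTU ht)
    refine ⟨ε / 4, by positivity, fun x hx => hball ?_⟩
    rw [mem_ball, Real.dist_eq, abs_lt]
    constructor <;> linarith [hx.1, hx.2]
  choose! r hr hrU using hnhd
  obtain ⟨S, hST, hcov⟩ := hT.elim_nhds_subcover (fun t => Ioo (t - r t) (t + r t)) fun t ht =>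
    Ioo_mem_nhds (by linarith [hr t ht]) (by linarith [hr t ht])
  refine ⟨S.image fun t => (t, r t), ?_, fun x hx => ?_⟩
  · intro p hp
    obtain ⟨t, htS, rfl⟩ := Finset.mem_image.1 hp
    refine ⟨hr t (hST t htS), (Icc_subset_Icc (by linarith [hr t (hST t htS)])
      (by linarith [hr t (hST t htS)])).trans (hrU t (hST t htS))⟩
  · have := hcov hx
    simp only [mem_iUnion, exists_prop] at this
    obtain ⟨t, htS, hxt⟩ := this
    simp only [mem_iUnion, exists_prop, Finset.mem_image]
    exact ⟨(t, r t), ⟨t, htS, rfl⟩, Ioo_subset_Icc_self hxt⟩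

variable {E : Type*} [PseudoMetricSpace E]

/-- **Almost every level set is finite, along a compact set of good parameters.**  `γ` continuous
of bounded variation on `[a, b]`, `F` Lipschitz near each point of an open `O`, `T ⊆ [a, b]`
compact with `γ(T) ⊆ O`: for a.e. `s`, `{t ∈ T | F (γ t) = s}` is finite.
[cite: Federer1969, 2.10.25] -/
theorem ae_finite_levelSet_inter_of_isCompact {F : E → ℝ} {γ : ℝ → E} {a b : ℝ} {O : Set E}
    {T : Set ℝ} (hO : IsOpen O) (hγ : Continuous γ) (hbv : BoundedVariationOn γ (Icc a b))
    (hF : ∀ x ∈ O, ∃ C : ℝ≥0, ∃ t ∈ 𝓝 x, LipschitzOnWith C F t) (hT : IsCompact T)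
    (hTab : T ⊆ Icc a b) (hTO : MapsTo γ T O) :
    ∀ᵐ s ∂(volume : Measure ℝ), {t ∈ T | F (γ t) = s}.Finite := by
  classical
  -- cover `T` by finitely many closed intervals inside `γ⁻¹(O)`
  have hUo : IsOpen (γ ⁻¹' O) := hO.preimage hγ
  obtain ⟨P, hP, hcov⟩ := exists_finset_Icc_cover hT hUo fun t ht => hTO ht
  -- on each interval (cut down to `[a, b]`) the composite is continuous of bounded variation
  have hpiece : ∀ p ∈ P, ∀ᵐ s ∂(volume : Measure ℝ),
      (Icc (max a (p.1 - p.2)) (min b (p.1 + p.2)) ∩ (F ∘ γ) ⁻¹' {s}).Finite := by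
    intro p hp
    set a' := max a (p.1 - p.2) with ha'
    set b' := min b (p.1 + p.2) with hb'
    have hsub : Icc a' b' ⊆ Icc (p.1 - p.2) (p.1 + p.2) := Icc_subset_Icc (le_max_right _ _) (min_le_right _ _)
    have hsub' : Icc a' b' ⊆ Icc a b := Icc_subset_Icc (le_max_left _ _) (min_le_left _ _)
    have hmaps : MapsTo γ (Icc a' b') O := fun t ht => (hP p hp).2 (hsub ht)
    have hbv' : BoundedVariationOn (F ∘ γ) (Icc a' b') :=
      boundedVariationOn_comp_of_locallyLipschitzOn hγ.continuousOn hmaps hF (hbv.mono hsub')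
    have hcont : ContinuousOn (F ∘ γ) (Icc a' b') := by
      intro t ht
      obtain ⟨C, u, hu, hC⟩ := hF (γ t) (hmaps ht)
      have h1 : ContinuousAt F (γ t) := hC.continuousOn.continuousAt hu
      exact (h1.comp hγ.continuousAt).continuousWithinAt
    exact ae_finite_levelSet_of_boundedVariationOn hcont hbv'
  -- intersect the finitely many full-measure sets
  have hall : ∀ᵐ s ∂(volume : Measure ℝ), ∀ p ∈ P,
      (Icc (max a (p.1 - p.2)) (min b (p.1 + p.2)) ∩ (F ∘ γ) ⁻¹' {s}).Finite :=
    (ae_ball_iff P.countable_toSet).2 hpiece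
  filter_upwards [hall] with s hs
  refine (Finset.finite_toSet P).biUnion (fun p hp => hs p hp) |>.subset ?_
  rintro t ⟨htT, hts⟩
  have := hcov htT
  simp only [mem_iUnion, exists_prop] at this
  obtain ⟨p, hp, htp⟩ := this
  simp only [mem_iUnion, exists_prop]
  exact ⟨p, hp, ⟨max_le (hTab htT).1 htp.1, le_min (hTab htT).2 htp.2⟩, hts⟩

end Literature.Analysis.FunctionSpaces

end
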